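import Summits.PneNP.PneNP.Theorems.ResolutionCannotProvePrimality.Negative.CornerPrimesList

/-!
# Corner primes IV — `balancedCNF n p` has `O(n²)`-line resolution refutations whenever
`4^(n-1) ≤ p < 4^(n-1) + 2^(n-1)`; hence `CornerPrimesIO → ¬ ResolutionCannotProvePrimality`
(negative lemma for crux `stmt-PneNP-16923`, `PrimalityPlaces.ResolutionCannotProvePrimality`)

The crux asserts: `∃ ε > 0 ∃ N ∀ n ≥ N ∀ p` prime with `4^(n-1) ≤ p < 4^n`, every resolution
refutation of `balancedCNF n p` (the array-multiplier CNF "`x · y = p`, `x_{n-1} = y_{n-1} = 1`")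
has `≥ 2^(n^ε)` lines.  Its universal quantifier over ALL primes of the range includes the primes
of the thin *corner window* `[4^(n-1), 4^(n-1) + 2^(n-1))`, where the statement fails:

* `exists_isResRefutation` — for `n ≥ 3` and every `p` whose bits `n-1, …, 2n-3` and `2n-1`
  vanish and whose bit `0` is `1` (in particular every odd `p` of the window, `testBit_high`),
  `bal n p = balancedCNF n p` has a resolution refutation with `≤ 4 · |cornerL n| ≤ 260 · n²` lines
  (`length_cornerL_le`): arithmetically `x = 2^(n-1) + a`, `y = 2^(n-1) + b` give
  `xy = 4^(n-1) + 2^(n-1)(a+b) + ab`, so the window forces `a = b = 0`; resolution sees this gate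
  by gate ("zero cascade" of `CornerPrimesCells` / `CornerPrimesRows`).  No step uses primality.
* `ResolutionCannotProvePrimality_false_of_CornerPrimesIO` — hence the crux is FALSE as soon as
  `CornerPrimesIO` holds: for infinitely many `n` some prime lies in the corner window (the case
  `m = 2^(n-1)` of "a prime between `m²` and `m² + m`", Oppermann/Legendre-type, implied by
  Cramér's conjecture; the least prime above `4^(n-1)` is inside the window for every `n ≤ 64`
  checked; OPEN — Baker–Harman–Pintz' primes in `[x, x + x^0.525]` are far too weak).  The same
  cascade with a window `2^(n-1+t)` leaves `2t` free input bits and gives refutations of size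
  `O(n² 4^t)` and width `2t + O(1)` (paper proof in the item's evidence `corner-primes.md`); with
  `t = O(log n)` that window is guaranteed by RH (Cramér 1920: gaps `O(√p log p)`), so the crux is
  also false under RH, and its sibling `PrimalityWidthHard` (width `≥ εn`) fails on the same
  instances (width `4` at `t = 0`).  Conversely the crux as stated could only be TRUE if the corner
  windows were prime-free for all large `n`.  Repair (planner): keep `p` away from the corners of
  the box `[2^(n-1), 2^n)²`, e.g. `2 · 4^(n-1) ≤ p ≤ 3 · 4^(n-1)`.

Evidence (refuter seat `rattack-stmt-PneNP-16923`): `corner-primes.md` (construction, table), the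
generator/independent checker `corner.py` (explicit refutations for `n = 2 … 40`, ≈ `42 n²` lines,
width 4, all verified against a re-implementation of `IsResRefutation`), kit job `j023082`.

References: J. Krajíček, P. Pudlák, *Some consequences of cryptographical conjectures for S¹₂ and
EF*, Inform. Comput. 140 (1998) §4; J. Krajíček, *Proof Complexity* (CUP 2019) §5.1; H. Cramér,
*Some theorems concerning prime numbers*, Ark. Mat. Astr. Fys. 15 (1920); R. C. Baker, G. Harman,
J. Pintz, *The difference between consecutive primes II*, Proc. LMS 83 (2001); L. Oppermann (1882).
-/

set_option linter.dupNamespace false -- `Summit.PneNP.PneNP.…`: summit = sub-problem (D-0017)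

open Literature.Computability.Complexity Literature.Computability.MetaComplexity

namespace Summit.PneNP.PneNP.Theorems.ResolutionCannotProvePrimality.Negative

/-- **`ResolutionCannotProvePrimality` is false under `CornerPrimesIO`.** For every prime (indeed
every odd number) `p` in the corner window, `balancedCNF n p` has a resolution refutation with at
most `260 · n²` lines (`exists_isResRefutation`, `length_cornerL_le`), which is eventually below
`2^(n^ε)` for every `ε > 0`. -/
theorem ResolutionCannotProvePrimality_false_of_CornerPrimesIO (hH : CornerPrimesIO) :
    ¬ Theses.PrimalityPlaces.ResolutionCannotProvePrimality := by
  rw [resolutionCannotProvePrimality_iff]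
  rintro ⟨ε, hε, N, hN⟩
  obtain ⟨N₁, hN₁⟩ := eventually_lt_two_rpow 260 hε
  obtain ⟨n, hn, p, hp, hlo, hhi⟩ := hH (max N (max N₁ 3))
  have hnN : N ≤ n := (le_max_left _ _).trans hn
  have hnN₁ : N₁ ≤ n := ((le_max_left _ _).trans (le_max_right _ _)).trans hn
  have hn3 : 3 ≤ n := ((le_max_right _ _).trans (le_max_right _ _)).trans hn
  have h16 : 4 ^ 2 ≤ 4 ^ (n - 1) := Nat.pow_le_pow_right (by norm_num) (by omega)
  have hodd : p % 2 = 1 := hp.eq_two_or_odd.resolve_left (by omega)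
  have hbit0 : Nat.testBit p 0 = true := by
    rw [Nat.testBit_zero]; exact decide_eq_true hodd
  obtain ⟨π, href, hlen⟩ := exists_isResRefutation hn3
    (fun j hj hj2 => testBit_high (by omega) hlo hhi hj hj2) hbit0
  have hA : 2 ^ (n - 1) ≤ 4 ^ (n - 1) := Nat.pow_le_pow_left (by norm_num) _
  have hB : 4 ^ n = 4 ^ (n - 1) * 4 := by rw [← pow_succ]; congr 1; omega
  have hp4 : p < 4 ^ n := by omega
  have h1 := hN n hnN p hp hlo hp4 π href
  have hlen' : π.length ≤ 260 * n ^ 2 := hlen.trans (by have := length_cornerL_le hn3; omega)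
  have h2 : (π.length : ℝ) ≤ 260 * (n : ℝ) ^ 2 := by exact_mod_cast hlen'
  have h3 : (260 : ℝ) * (n : ℝ) ^ 2 < (2 : ℝ) ^ ((n : ℝ) ^ ε) := by exact_mod_cast hN₁ n hnN₁
  linarith


end Summit.PneNP.PneNP.Theorems.ResolutionCannotProvePrimality.Negative
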